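import Summits.CriticalPhenomena.SAWScalingLimit.Theorems.SAWDefectDecoherenceBoundaryClosureRPolygonLimitDataBounds
import Summits.CriticalPhenomena.SAWScalingLimit.Theorems.SAWDefectDecoherenceBoundaryClosureRPolygonLimitDataDuality
import Summits.CriticalPhenomena.SAWScalingLimit.Theorems.SAWDefectDecoherenceBoundaryClosureRHolomorphicWeakLimits
import Summits.CriticalPhenomena.SAWScalingLimit.Theorems.SAWDefectDecoherenceConjugateClassNegligibleOfCruxes
import Summits.CriticalPhenomena.SAWScalingLimit.Theorems.SAWDefectDecoherenceBoundaryClosureRLocalL1WeakStar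
import Summits.CriticalPhenomena.SAWScalingLimit.Theorems.SAWDefectDecoherenceBoundaryClosureRSideMeasure
import HarnessLib

/-!
# Polygon limit data (registered stub `polygonLimitData`, piece C1 of the (A) assembly of
# `stub_polygonIdentification`; crux `BoundaryClosureR`, stmt-CriticalPhenomena-14004, line
# `polygon-parity-squeeze`)

For an exact-polygon admissible pinned datum with the polygon package hypotheses (`L¹` law on the
compacts of `closure Ω` off the root, root tightness, boundary layer budgets off the root),
`DefectDecoherence` and `MassRatio`, every mesh sequence `ns → 0⁺` has a subsequence `ns ∘ ms` carrying
the LIMIT DATA `(g, μ, η)` of the assembly with its nine clauses: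
`g` holomorphic on `Ω` (`LocalL1.holWeakLimits_of_localL1`, fed by `ConjugateClassNegligible` from the
two cruxes); `η` the weak-* limit of the normalised bulk functionals on ALL continuous compactly
supported tests off the root (`LocalL1.pickEngine_weakStarLimit` on `U = ℂ ∖ {pt 0}`, fed by
`PolygonLimitData.massBound_midEdges`), agreeing with `∫ · g` inside `Ω`, with local sup-norm bounds;
`g ∈ L¹` on `K ∩ Ω` for compacts `K ∌ pt 0` and `∫_{B(pt 0, r) ∩ Ω} ‖g‖ → 0` (duality,
`PolygonLimitData.integrableOn_of_pairing_bound`, from the bounds of `η` resp. `RootTightAt`);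
`μ` the weak-* limit of the normalised positive boundary arrival measures
(`sideMeasure_weakStarLimit`, fed by `PolygonLimitData.massBound_darts`), finite on compacts off the
root and carried by `∂Ω` (`PolygonLimitData.darts_eventually_avoid` +
`PolygonLimitData.measure_eq_zero_of_forall_integral_eq_zero`).
-/

noncomputable section

open scoped BigOperators Topology Classical
open Filter Set Metric MeasureTheory
open Literature.Probability.LatticeModels Literature.Probability.RandomPlanarGeometry
open Literature.Probability.RandomPlanarGeometry.SAW
open Summit.CriticalPhenomena.SAWScalingLimit.Theses.SAWDefectDecoherence
open Summit.CriticalPhenomena.SAWScalingLimit.Theorems.PickHalfPlane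
open Summit.CriticalPhenomena.SAWScalingLimit.Theorems.MassRatio.Negative (hexDomainMidEdges_finite)
open Summit.CriticalPhenomena.SAWScalingLimit.Theorems.PolygonParitySqueeze.PolygonLimitData

namespace Summit.CriticalPhenomena.SAWScalingLimit.Theorems.PolygonParitySqueeze

namespace PolygonLimitData

/-! ### The normalised functional against a bounded test -/

/-- **`‖N_δ(ψ)‖` versus the local `L¹` mass.** If `‖ψ‖ ≤ M` and `ψ ≠ 0` only on `S`, then
`‖δ² (Σ_{z ∈ Ω(Λ)} ψ(δ mid z) F(z)) / F(b)‖ ≤ M · δ² Σ_{z ∈ Ω(Λ), δ mid z ∈ S} ‖F(z)‖ / ‖F(b)‖`.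
[folklore] -/
theorem norm_NF_le (Λ : Finset HexVertex) (F : Sym2 HexVertex → ℂ) (Fb : ℂ) (δ : ℝ) {ψ : ℂ → ℂ}
    {M : ℝ} {S : Set ℂ} (hM : ∀ z, ‖ψ z‖ ≤ M) (hS : ∀ z, ψ z ≠ 0 → z ∈ S) :
    ‖(δ : ℂ) ^ 2 * (∑ᶠ z ∈ hexDomainMidEdges Λ, ψ ((δ : ℂ) * hexMidpoint z) * F z) / Fb‖ ≤
      M * (δ ^ 2 * ∑ᶠ z ∈ {z : Sym2 HexVertex | z ∈ hexDomainMidEdges Λ ∧ (δ : ℂ) * hexMidpoint z ∈ S},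
        ‖F z‖) / ‖Fb‖ := by
  classical
  have hE := hexDomainMidEdges_finite Λ
  have hW : {z : Sym2 HexVertex | z ∈ hexDomainMidEdges Λ ∧ (δ : ℂ) * hexMidpoint z ∈ S}.Finite :=
    GateMass.finite_midEdgeWindow Λ _
  -- the numerator
  have hnum : ‖∑ᶠ z ∈ hexDomainMidEdges Λ, ψ ((δ : ℂ) * hexMidpoint z) * F z‖ ≤
      M * ∑ᶠ z ∈ {z : Sym2 HexVertex | z ∈ hexDomainMidEdges Λ ∧ (δ : ℂ) * hexMidpoint z ∈ S}, ‖F z‖ := by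
    rw [finsum_mem_eq_finite_toFinset_sum _ hE, finsum_mem_eq_finite_toFinset_sum _ hW]
    have hsub : hW.toFinset = hE.toFinset.filter (fun z => (δ : ℂ) * hexMidpoint z ∈ S) := by
      ext z; simp only [Set.Finite.mem_toFinset, Finset.mem_filter, Set.mem_setOf_eq]
    rw [hsub, Finset.sum_filter, Finset.mul_sum]
    refine (norm_sum_le _ _).trans (Finset.sum_le_sum fun z _ => ?_)
    split_ifs with hz
    · rw [norm_mul]; exact mul_le_mul_of_nonneg_right (hM _) (norm_nonneg _)
    · have h0 : ψ ((δ : ℂ) * hexMidpoint z) = 0 := by by_contra h; exact hz (hS _ h)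
      rw [h0, zero_mul, norm_zero, mul_zero]
  rw [norm_div, norm_mul, norm_pow, Complex.norm_real, Real.norm_eq_abs, sq_abs]
  by_cases hFb : ‖Fb‖ = 0
  · rw [hFb, div_zero, div_zero]
  · have hFb' : 0 < ‖Fb‖ := lt_of_le_of_ne (norm_nonneg _) (Ne.symm hFb)
    rw [div_le_div_iff_of_pos_right hFb', mul_left_comm]
    exact mul_le_mul_of_nonneg_left hnum (sq_nonneg _)

end PolygonLimitData

/-! ### The registered stub -/

/-- **Registered stub `polygonLimitData`** (piece C1 of the (A) assembly of
`stub_polygonIdentification`, crux item stmt-CriticalPhenomena-14004, line `polygon-parity-squeeze`):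
the subsequential limit data `(g, μ, η)` of an exact-polygon admissible pinned datum under the polygon
package hypotheses, `DefectDecoherence` and `MassRatio`, with the nine LIMDATA clauses (holomorphy;
bulk convergence off the root; representation inside; local bounds; local `L¹`; root `L¹`-tightness;
local finiteness of `μ`; `μ` carried by `∂Ω`; side convergence).  See the module docstring for the
proof. [cite: DuminilCopinSmirnov2012, Conjecture 2 (normalised observable)] -/
theorem polygonLimitData : ∀ (D : DobrushinDomain) (ρ : ℝ) (Λ : ℝ → Finset HexVertex) (m : ℝ → ℤ) (b : ℝ → Sym2 HexVertex), AdmissibleFamily D ρ Λ m b → ExactPolygonFamily D Λ → ∀ (a : ℝ → Sym2 HexVertex) (r₀ : ℝ) (m₀ : ℝ → ℤ), PinnedFlatRoot D Λ b (D.pt 0) a r₀ m₀ → 2 * ρ < dist (D.pt 0) (D.pt 1) → (∀ K : Set ℂ, IsCompact K → K ⊆ closure D.carrier → D.pt 0 ∉ K → L1BoundOn Λ a b K) → RootTightAt Λ a b (D.pt 0) → (∀ z ∈ frontier D.carrier, z ≠ D.pt 0 → BoundaryLayerBudgetAt Λ a b z) → DefectDecoherence → MassRatio → ∀ (ns : ℕ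 → ℝ), Filter.Tendsto ns Filter.atTop (𝓝[>] 0) → ∃ (ms : ℕ → ℕ) (g : ℂ → ℂ) (μ : MeasureTheory.Measure ℂ) (η : (ℂ → ℂ) → ℂ), StrictMono ms ∧ DifferentiableOn ℂ g D.carrier ∧ (∀ ψ : ℂ → ℂ, Continuous ψ → HasCompactSupport ψ → D.pt 0 ∉ tsupport ψ → Filter.Tendsto (fun n => NF Λ a b ((fun n => ns (ms n)) n) ψ) Filter.atTop (𝓝 (η ψ))) ∧ (∀ ψ : ℂ → ℂ, Continuous ψ → HasCompactSupport ψ → tsupport ψ ⊆ D.carrier → η ψ = ∫ z, ψ z * g z) ∧ (∀ K : Set ℂ, IsCompact K → D.pt 0 ∉ K → ∃ C : ℝ, ∀ ψ : ℂ → ℂ, Continuous ψ → tsupport ψ ⊆ K → ∀ M : ℝ, (∀ z, ‖ψ z‖ ≤ M) → ‖η ψ‖ ≤ C * M) ∧ (∀ K : Set ℂ, IsCompact K → D.pt 0 ∉ K → MeasureTheory.IntegrableOn g (K ∩ D.carrier)) ∧ (∀ ε : ℝ, 0 < ε → ∃ r : ℝ, 0 < r ∧ ∫ z in Metric.ball (D.pt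 0) r ∩ D.carrier, ‖g z‖ ≤ ε) ∧ (∀ K : Set ℂ, IsCompact K → D.pt 0 ∉ K → μ K < ⊤) ∧ μ (frontier D.carrier)ᶜ = 0 ∧ (∀ w : ℂ → ℝ, Continuous w → HasCompactSupport w → D.pt 0 ∉ tsupport w → Filter.Tendsto (fun n => ((fun n => ns (ms n)) n) * ∑ᶠ e ∈ hexDomainBoundary (Λ ((fun n => ns (ms n)) n)), w ((((fun n => ns (ms n)) n : ℝ) : ℂ) * hexMidpoint e) * (‖hexParafermionicObservable (Λ ((fun n => ns (ms n)) n)) (a ((fun n => ns (ms n)) n)) hexCriticalFugacity 0 e‖ / ‖hexParafermionicObservable (Λ ((fun n => ns (ms n)) n)) (a ((fun n => ns (ms n)) n)) hexCriticalFugacity 0 (b ((fun n => ns (ms n)) n))‖)) Filter.atTop (𝓝 (∫ z, w z ∂μ))) := by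
  intro D ρ Λ m b hAF hEP a r₀ m₀ hPR _hρd hL1 hRT hBL hDD hMR ns hns
  ---------------------------------------------------------------- basic facts
  have hpt0F : D.pt 0 ∈ frontier D.carrier := D.pt_mem_frontier 0
  have hpt0D : D.pt 0 ∉ D.carrier := fun h => by
    have h' : D.pt 0 ∈ D.carrier ∩ frontier D.carrier := ⟨h, hpt0F⟩
    rw [D.isOpen.inter_frontier_eq] at h'
    exact h'
  set U : Set ℂ := {D.pt 0}ᶜ with hUdef
  have hU : IsOpen U := isOpen_compl_singleton
  have hKU : ∀ K : Set ℂ, K ⊆ U ↔ D.pt 0 ∉ K := fun K => subset_compl_singleton_iff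
  have hnormev := LocalL1.eventually_normaliser_ne_zero_of_bundles hAF.2.2.1 hPR.2.2.1
  ---------------------------------------------------------------- (1) the functional `η` on `U`
  have hL1U : ∀ K : Set ℂ, IsCompact K → K ⊆ U → ∃ C : ℝ, ∀ᶠ δ : ℝ in 𝓝[>] 0,
      δ ^ 2 * (∑ᶠ z ∈ {z : Sym2 HexVertex | z ∈ hexDomainMidEdges (Λ δ) ∧ (δ : ℂ) * hexMidpoint z ∈ K},
        ‖hexParafermionicObservable (Λ δ) (a δ) hexCriticalFugacity (5 / 8) z‖) ≤
      C * ‖hexParafermionicObservable (Λ δ) (a δ) hexCriticalFugacity (5 / 8) (b δ)‖ :=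
    fun K hK hKU' => massBound_midEdges hAF hEP hPR hL1 hBL K hK ((hKU K).1 hKU')
  obtain ⟨ms₁, hms₁, L, hLconv, -, -, hLbd, -⟩ := LocalL1.pickEngine_weakStarLimit Λ a b U hU hL1U ns hns
  set ns₁ : ℕ → ℝ := fun n => ns (ms₁ n) with hns₁def
  have hns₁ : Tendsto ns₁ atTop (𝓝[>] 0) := hns.comp hms₁.tendsto_atTop
  ---------------------------------------------------------------- (2) the holomorphic `g` along `ns₁`
  have hL1D : ∀ K : Set ℂ, IsCompact K → K ⊆ D.carrier → ∃ C : ℝ, ∀ᶠ δ : ℝ in 𝓝[>] 0,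
      δ ^ 2 * (∑ᶠ z ∈ {z : Sym2 HexVertex | z ∈ hexDomainMidEdges (Λ δ) ∧ (δ : ℂ) * hexMidpoint z ∈ K},
        ‖hexParafermionicObservable (Λ δ) (a δ) hexCriticalFugacity (5 / 8) z‖) ≤
      C * ‖hexParafermionicObservable (Λ δ) (a δ) hexCriticalFugacity (5 / 8) (b δ)‖ :=
    fun K hK hKD => hL1 K hK (hKD.trans subset_closure) (fun h => hpt0D (hKD h))
  obtain ⟨ms₂, hms₂, g, hg, hgconv⟩ := LocalL1.holWeakLimits_of_localL1
    (conjugateClassNegligible_of_exponent_cruxes hDD hMR) D ρ Λ m b hAF a r₀ m₀ hPR hL1D ns₁ hns₁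
  set ns₂ : ℕ → ℝ := fun n => ns₁ (ms₂ n) with hns₂def
  have hns₂ : Tendsto ns₂ atTop (𝓝[>] 0) := hns₁.comp hms₂.tendsto_atTop
  ---------------------------------------------------------------- (3) the side measure along `ns₂`
  have hMU : ∀ K : Set ℂ, IsCompact K → K ⊆ U → ∃ C : ℝ, ∀ᶠ δ : ℝ in 𝓝[>] 0,
      δ * (∑ᶠ e ∈ {e : Sym2 HexVertex | e ∈ hexDomainBoundary (Λ δ) ∧ (δ : ℂ) * hexMidpoint e ∈ K},
        ‖hexParafermionicObservable (Λ δ) (a δ) hexCriticalFugacity 0 e‖) ≤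
      C * ‖hexParafermionicObservable (Λ δ) (a δ) hexCriticalFugacity 0 (b δ)‖ :=
    fun K hK hKU' => massBound_darts hAF hPR hBL K hK ((hKU K).1 hKU')
  obtain ⟨ms₃, hms₃, μ, hμfin, hμconv⟩ := sideMeasure_weakStarLimit_of_localMass Λ a b hU hMU ns₂ hns₂
  ---------------------------------------------------------------- the final subsequence and `η`
  set ms : ℕ → ℕ := fun n => ms₁ (ms₂ (ms₃ n)) with hmsdef
  have hms : StrictMono ms := hms₁.comp (hms₂.comp hms₃)
  have hms₂₃ : StrictMono fun n => ms₂ (ms₃ n) := hms₂.comp hms₃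
  have hnsms : Tendsto (fun n => ns (ms n)) atTop (𝓝[>] 0) := hns.comp hms.tendsto_atTop
  set η : (ℂ → ℂ) → ℂ := fun ψ => if h : Continuous ψ then L ⟨ψ, h⟩ else 0 with hηdef
  have hηL : ∀ (ψ : ℂ → ℂ) (hψ : Continuous ψ), η ψ = L ⟨ψ, hψ⟩ := fun ψ hψ => by
    simp only [hηdef, dif_pos hψ]
  ---------------------------------------------------------------- P_bulk, P_in, P_bd
  have hPbulk : ∀ ψ : ℂ → ℂ, Continuous ψ → HasCompactSupport ψ → D.pt 0 ∉ tsupport ψ →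
      Tendsto (fun n => NF Λ a b (ns (ms n)) ψ) atTop (𝓝 (η ψ)) := by
    intro ψ hψ hψc hψ0
    have h := (hLconv ⟨ψ, hψ⟩ hψc ((hKU _).2 hψ0)).comp hms₂₃.tendsto_atTop
    rw [hηL ψ hψ]
    exact h
  have hgin : ∀ ψ : ℂ → ℂ, Continuous ψ → HasCompactSupport ψ → tsupport ψ ⊆ D.carrier →
      Tendsto (fun n => NF Λ a b (ns (ms n)) ψ) atTop (𝓝 (∫ z, ψ z * g z)) :=
    fun ψ hψ hψc hψD => (hgconv ψ ⟨hψ, hψc, hψD⟩).comp hms₃.tendsto_atTop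
  have hPin : ∀ ψ : ℂ → ℂ, Continuous ψ → HasCompactSupport ψ → tsupport ψ ⊆ D.carrier →
      η ψ = ∫ z, ψ z * g z := fun ψ hψ hψc hψD =>
    tendsto_nhds_unique (hPbulk ψ hψ hψc fun h => hpt0D (hψD h)) (hgin ψ hψ hψc hψD)
  have hPbd : ∀ K : Set ℂ, IsCompact K → D.pt 0 ∉ K → ∃ C : ℝ, ∀ ψ : ℂ → ℂ, Continuous ψ →
      tsupport ψ ⊆ K → ∀ M : ℝ, (∀ z, ‖ψ z‖ ≤ M) → ‖η ψ‖ ≤ C * M := by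
    intro K hK hK0
    obtain ⟨C, -, hC⟩ := hLbd K hK ((hKU K).2 hK0)
    refine ⟨C, fun ψ hψ hψK M hM => ?_⟩
    rw [hηL ψ hψ]
    exact hC ⟨ψ, hψ⟩ hψK M hM
  ---------------------------------------------------------------- P_L1 (duality from the bounds of `η`)
  have hPL1 : ∀ K : Set ℂ, IsCompact K → D.pt 0 ∉ K → IntegrableOn g (K ∩ D.carrier) := by
    intro K hK hK0
    obtain ⟨K', hK'c, hKK', hK'U⟩ := exists_compact_between hK hU ((hKU K).2 hK0)
    obtain ⟨C, -, hC⟩ := hLbd K' hK'c hK'U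
    have hV : IsOpen (interior K' ∩ D.carrier) := isOpen_interior.inter D.isOpen
    have hgV : ContinuousOn g (interior K' ∩ D.carrier) := hg.continuousOn.mono inter_subset_right
    have key := (integrableOn_of_pairing_bound hV hgV (C := C) fun ψ hψ hψc hψV hψ1 => by
      rw [← hPin ψ hψ hψc (hψV.trans inter_subset_right), hηL ψ hψ]
      have h := hC ⟨ψ, hψ⟩ (hψV.trans (inter_subset_left.trans interior_subset)) 1 hψ1
      rw [mul_one] at h
      exact h).1
    exact key.mono_set (inter_subset_inter_left _ hKK')
  ---------------------------------------------------------------- P_root (duality from `RootTightAt`)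
  have hProot : ∀ ε : ℝ, 0 < ε → ∃ r : ℝ, 0 < r ∧ ∫ z in ball (D.pt 0) r ∩ D.carrier, ‖g z‖ ≤ ε := by
    intro ε hε
    obtain ⟨r, hr, hev⟩ := hRT (ε / 2) (half_pos hε)
    refine ⟨r, hr, ?_⟩
    have hV : IsOpen (ball (D.pt 0) r ∩ D.carrier) := isOpen_ball.inter D.isOpen
    have hgV : ContinuousOn g (ball (D.pt 0) r ∩ D.carrier) := hg.continuousOn.mono inter_subset_right
    have key := (integrableOn_of_pairing_bound hV hgV (C := ε / 2) fun ψ hψ hψc hψV hψ1 => by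
      have hlim := (hgin ψ hψ hψc (hψV.trans inter_subset_right)).norm
      have hS : ∀ z, ψ z ≠ 0 → z ∈ ball (D.pt 0) r := fun z hz => (hψV (subset_tsupport _ hz)).1
      refine le_of_tendsto hlim ?_
      filter_upwards [hnsms.eventually hev, hnsms.eventually hnormev] with n hn hnn
      refine (norm_NF_le (Λ (ns (ms n)))
        (hexParafermionicObservable (Λ (ns (ms n))) (a (ns (ms n))) hexCriticalFugacity (5 / 8))
        (hexParafermionicObservable (Λ (ns (ms n))) (a (ns (ms n))) hexCriticalFugacity (5 / 8) (b (ns (ms n))))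
        (ns (ms n)) hψ1 hS).trans ?_
      rw [one_mul, div_le_iff₀ (norm_pos_iff.2 hnn.1)]
      exact hn).2
    linarith
  ---------------------------------------------------------------- P_mf, P_ms, P_side
  have hPmf : ∀ K : Set ℂ, IsCompact K → D.pt 0 ∉ K → μ K < ⊤ := fun K hK hK0 => hμfin K hK ((hKU K).2 hK0)
  have hOU : (frontier D.carrier)ᶜ ⊆ U := fun z hz hz0 => hz (by rw [mem_singleton_iff.1 hz0]; exact hpt0F)
  have hPms : μ (frontier D.carrier)ᶜ = 0 := by
    refine measure_eq_zero_of_forall_integral_eq_zero (U := U) isClosed_frontier.isOpen_compl hOU hμfin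
      fun w hw hwc hwO _ => ?_
    obtain ⟨f, hf0, hfconv⟩ : ∃ f : ℕ → ℝ, (∀ᶠ n in atTop, f n = 0) ∧ Tendsto f atTop (𝓝 (∫ z, w z ∂μ)) := by
      refine ⟨_, ?_, hμconv w hw hwc (hwO.trans hOU)⟩
      filter_upwards [hnsms.eventually (darts_eventually_avoid hAF hwc hwO)] with n hn
      exact mul_eq_zero_of_right _ (finsum_mem_of_eqOn_zero fun e he =>
        mul_eq_zero_of_left (image_eq_zero_of_notMem_tsupport (hn e he)) _)
    exact tendsto_nhds_unique hfconv (tendsto_const_nhds.congr' (hf0.mono fun n hn => hn.symm))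
  exact ⟨ms, g, μ, η, hms, hg, hPbulk, hPin, hPbd, hPL1, hProot, hPmf, hPms,
    fun w hw hwc hw0 => hμconv w hw hwc ((hKU _).2 hw0)⟩

end Summit.CriticalPhenomena.SAWScalingLimit.Theorems.PolygonParitySqueeze

end
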